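import Summits.KontsevichZagierPeriods.KontsevichZagierPeriods.Theorems.LogPrimitiveNL.Negative.Rigidity
import Summits.KontsevichZagierPeriods.KontsevichZagierPeriods.Theorems.LogPrimitiveNL.Negative.Defs
import Summits.KontsevichZagierPeriods.KontsevichZagierPeriods.Theorems.GammaHodgeSector.Negative.Algebraicity
import Literature.NumberTheory.Transcendental.LindemannWeierstrassProofs
import Literature.NumberTheory.Transcendental.BakerLogarithmsConclusion
import Literature.NumberTheory.Transcendental.SemialgebraicMapsProofs

/-!
# Crux `LiouvilleUnfolding.LogPrimitiveNL` (stmt-KontsevichZagierPeriods-2836): the one-point base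

Negative-side (cdisprove) support. Over the base `ℝ⁰` (`n = 0`) the data of the crux are algebraic
CONSTANTS `hᵢ`, `a`, `b` and semialgebraic functions `Vᵢ` of `t`; the content of the crux there is
Baker's theorem plus the product-rule template of `KZLogCalculusProofs.lean` (work file
`Cruxes/LogPrimitiveNL/Disproof.lean`, §7.4).

* `DimZero`, `BoundaryRigidityDimZero` — the `n = 0` cases of the crux and of `BoundaryRigidity`,
  typed as a prover's first milestone, with `dimZero_of_crux`, `boundaryRigidityDimZero_of_crux`.
* `dimZero_one_balanced` — RIGIDITY in the smallest case, proved: in an admissible datum with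
  `n = 0`, `k = 1`, either `h = 0` or `V(·, b) = V(·, a)` (the boundary term is an algebraic number
  of the form `h · log(V(b)/V(a))` with `h, V(a), V(b)` algebraic — values of `ℚ`-semialgebraic
  functions over the point, `isAlgebraic_of_isSemialgebraicFunOn_fin_zero`, via
  `GammaHodgeSectorNegative.isAlgebraic_of_isSemialgebraic_singleton` — and
  Hermite–Lindemann `transcendental_exp_holds` forbids a non-zero algebraic logarithm of an algebraic
  number, `log_eq_zero_of_isAlgebraic`). So every admissible one-monomial instance over the point has
  `[r'] = [pt, 0]`.
* ALL `k`, from Baker (`baker_holds`, PROVED in tree): `baker_sum_eq_zero` — an algebraic value of a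
  `ℚ̄`-linear form in logarithms of algebraic numbers is `0` (maximal `ℚ`-independent subfamily +
  Theorem 2.1 ⇒ `1 ∉ span_ℚ̄`) ⇒ `dimZero_boundary_eq_zero` (every admissible `r'` over the point has
  integrand `0`) ⇒ `dimZero_base_mem_relations` (`[r'] ∈ KZ.relations`): at `n = 0` the crux is
  exactly "`[r] ∈ relations` for every admissible band datum".
Algebraicity of `ℚ`-semialgebraic points of `ℝ¹` is imported from
`GammaHodgeSector/Negative/Algebraicity.lean` (`isAlgebraic_of_isSemialgebraic_singleton`).
-/

noncomputable section

open Set MeasureTheory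
open Literature.NumberTheory.Transcendental

namespace Summit.KontsevichZagierPeriods.LiouvilleUnfolding.LogPrimitiveNL.Negative

open Summit.KontsevichZagierPeriods.KontsevichZagierPeriods.Theses.LiouvilleUnfolding (LogPrimitiveNL)

/-! ## The `n = 0` cases, typed -/

/-- The crux in dimension `n = 0` (base `ℝ⁰`, band `⊂ ℝ¹`): `hᵢ`, `a`, `b` are (algebraic) constants,
`Vᵢ` semialgebraic functions of `t`; by the work file's §7.4 its content is Baker's theorem plus the product-rule
template in dimension `1` (and `affRep_sub_ptRep_mem_relations` of `TwoMoves.lean` is its smallest non-trivial instance). A prover's first milestone;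
`dimZero_of_crux` records that it is a special case. MILESTONE, NOT A HYPOTHESIS: a file assuming
`DimZero` proves nothing about the crux (D-0026); only the direction crux ⇒ `DimZero` is recorded. -/
def DimZero : Prop :=
  ∀ (k : ℕ) (r : KZ.IntegralRep 1) (r' : KZ.IntegralRep 0) (a b : (Fin 0 → ℝ) → ℝ)
    (h : Fin k → (Fin 0 → ℝ) → ℝ) (V V' : Fin k → (Fin 1 → ℝ) → ℝ),
    IsSemialgebraicFunOn ℚ r'.domain a →
    IsSemialgebraicFunOn ℚ r'.domain b →
    (∀ x ∈ r'.domain, a x ≤ b x) →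
    r.domain = {z | (Fin.init z : Fin 0 → ℝ) ∈ r'.domain ∧ a (Fin.init z) ≤ z (Fin.last 0) ∧
      z (Fin.last 0) ≤ b (Fin.init z)} →
    (∀ i, IsSemialgebraicFunOn ℚ r'.domain (h i)) →
    (∀ i, IsSemialgebraicFunOn ℚ r.domain (V i)) →
    (∀ i, ∀ z ∈ r.domain, 0 < V i z) →
    (∀ i, ∀ x ∈ r'.domain, ContinuousOn (fun t : ℝ => V i (Fin.snoc x t)) (Icc (a x) (b x))) →
    (∀ i, ∀ x ∈ r'.domain, ∀ t ∈ Ioo (a x) (b x),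
      HasDerivAt (fun s : ℝ => V i (Fin.snoc x s)) (V' i (Fin.snoc x t)) t) →
    (∀ i, IntegrableOn (fun z => h i (Fin.init z) * V' i z / V i z) r.domain) →
    (∀ x ∈ r'.domain, ∀ t ∈ Ioo (a x) (b x),
      r.integrand (Fin.snoc x t) = ∑ i, h i x * V' i (Fin.snoc x t) / V i (Fin.snoc x t)) →
    (∀ x ∈ r'.domain, r'.integrand x =
      ∑ i, h i x * (Real.log (V i (Fin.snoc x (b x))) - Real.log (V i (Fin.snoc x (a x))))) →
    KZ.of r - KZ.of r' ∈ KZ.relations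

/-- `DimZero` is the case `n = 0` of the crux. -/
theorem dimZero_of_crux (hc : LogPrimitiveNL) : DimZero :=
  fun k r r' a b h V V' => hc 0 k r r' a b h V V'

/-- Boundary rigidity over the point (typed `n = 0` case of `BoundaryRigidity`;
content = Baker: `Σ βᵢ log αᵢ` algebraic ⇒ the relation is ℚ-multiplicative). MILESTONE, NOT A
HYPOTHESIS (D-0026): only the direction crux ⇒ `BoundaryRigidityDimZero` is recorded. -/
def BoundaryRigidityDimZero : Prop :=
  ∀ (k : ℕ) (g : KZ.IntegralRep 0) (h W : Fin k → (Fin 0 → ℝ) → ℝ)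
    (U : Fin k → KZ.IntegralRep 1),
    (∀ i, IsSemialgebraicFunOn ℚ g.domain (h i)) →
    (∀ i, IsSemialgebraicFunOn ℚ g.domain (W i)) →
    (∀ i, ∀ x ∈ g.domain, 1 ≤ W i x) →
    (∀ i, (U i).domain = {z | (Fin.init z : Fin 0 → ℝ) ∈ g.domain ∧ 1 ≤ z (Fin.last 0) ∧
      z (Fin.last 0) ≤ W i (Fin.init z)}) →
    (∀ i, EqOn (U i).integrand (fun z => h i (Fin.init z) / z (Fin.last 0)) (U i).domain) →
    (∀ i, IntegrableOn (fun x => h i x * Real.log (W i x)) g.domain) →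
    (∀ x ∈ g.domain, g.integrand x = ∑ i, h i x * Real.log (W i x)) →
    ∑ i, KZ.of (U i) - KZ.of g ∈ KZ.relations

/-- `BoundaryRigidityDimZero` is the case `n = 0` of `BoundaryRigidity`, hence also a consequence of
the crux. -/
theorem boundaryRigidityDimZero_of_crux (hc : LogPrimitiveNL) : BoundaryRigidityDimZero :=
  fun k g h W U => boundaryRigidity_of_crux hc 0 k g h W U


/-! ## Rigidity in the smallest case: `n = 0`, `k = 1` instances are balanced -/

section DimZeroRigidity

/-- **Hermite–Lindemann for real logarithms**: an algebraic `w > 0` with algebraic `log w` has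
`log w = 0` (else `w = e^{log w}` would be transcendental, `transcendental_exp_holds`). -/
theorem log_eq_zero_of_isAlgebraic {w : ℝ} (hw : 0 < w) (halg : IsAlgebraic ℚ w)
    (hlog : IsAlgebraic ℚ (Real.log w)) : Real.log w = 0 := by
  by_contra hne
  have hC : IsAlgebraic ℚ ((Real.log w : ℝ) : ℂ) := hlog.algebraMap
  have hne' : ((Real.log w : ℝ) : ℂ) ≠ 0 := by exact_mod_cast hne
  have ht := transcendental_exp_holds hC hne'
  apply ht
  rw [← Complex.ofReal_exp, Real.exp_log hw]
  exact halg.algebraMap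

open Summit.KontsevichZagierPeriods.GammaHodgeSectorNegative (isAlgebraic_of_isSemialgebraic_singleton) in
/-- Over the point `ℝ⁰`, a `ℚ`-semialgebraic function has an algebraic value: its graph IS the
singleton `{(f x)} ⊂ ℝ¹`. -/
theorem isAlgebraic_of_isSemialgebraicFunOn_fin_zero {s : Set (Fin 0 → ℝ)} {f : (Fin 0 → ℝ) → ℝ}
    (hf : IsSemialgebraicFunOn ℚ s f) {x : Fin 0 → ℝ} (hx : x ∈ s) : IsAlgebraic ℚ (f x) := by
  have hset : {z : Fin 1 → ℝ | ∃ y ∈ s, z = Fin.snoc y (f y)} = {Fin.snoc x (f x)} := by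
    ext z
    simp only [mem_setOf_eq, mem_singleton_iff]
    constructor
    · rintro ⟨y, -, rfl⟩
      rw [Subsingleton.elim y x]
    · rintro rfl
      exact ⟨x, hx, rfl⟩
  have hsing : Literature.ModelTheory.ExponentialFields.IsSemialgebraic ℚ
      ({Fin.snoc x (f x)} : Set (Fin 1 → ℝ)) := by
    have h' : Literature.ModelTheory.ExponentialFields.IsSemialgebraic ℚ
        {z : Fin 1 → ℝ | ∃ y ∈ s, z = Fin.snoc y (f y)} := hf
    rwa [hset] at h'
  have := isAlgebraic_of_isSemialgebraic_singleton hsing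
  rwa [snoc_fin_one_apply_zero] at this

/-- Over the point, the endpoint value `y ↦ V (y, c y)` of a semialgebraic `V` on the band along a
semialgebraic edge `c` (with values in the band) is semialgebraic (composition, Tarski–Seidenberg:
`IsSemialgebraicFunOn.comp_isSemialgebraicMapOn_holds`). -/
theorem isSemialgebraicFunOn_endpoint {τ : Set (Fin 0 → ℝ)} {D : Set (Fin 1 → ℝ)}
    (hτ : Literature.ModelTheory.ExponentialFields.IsSemialgebraic ℚ τ)
    {c : (Fin 0 → ℝ) → ℝ} (hc : IsSemialgebraicFunOn ℚ τ c) {V : (Fin 1 → ℝ) → ℝ}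
    (hV : IsSemialgebraicFunOn ℚ D V) (hmaps : ∀ y ∈ τ, (Fin.snoc y (c y) : Fin 1 → ℝ) ∈ D) :
    IsSemialgebraicFunOn ℚ τ (fun y => V (Fin.snoc y (c y))) := by
  have hmap : IsSemialgebraicMapOn ℚ τ (fun y : Fin 0 → ℝ => (Fin.snoc y (c y) : Fin 1 → ℝ)) :=
    IsSemialgebraicMapOn.of_forall hτ fun j => by
      have ej : j = Fin.last 0 := Fin.ext (by have := j.isLt; simp only [Fin.val_last]; omega)
      subst ej
      exact hc.congr fun y _ => by simp
  exact IsSemialgebraicFunOn.comp_isSemialgebraicMapOn_holds hV hmap fun y hy => hmaps y hy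

/-- **Dimension `0`, one monomial: admissible instances are BALANCED.** In a datum of the crux with
`n = 0`, `k = 1` (only the hypotheses listed are used), over any base point either `h = 0` or
`V(·, b) = V(·, a)`: the boundary term `h·(log V(b) − log V(a))` is the value of the
`ℚ`-semialgebraic `r'.integrand`, hence algebraic, as are `h`, `V(a)`, `V(b)`; Hermite–Lindemann
forbids a non-zero algebraic logarithm of the algebraic number `V(b)/V(a)`. So `[r'] = [pt, 0]`
for every admissible `k = 1` instance over the point — the smallest case of the work file's §7.3(i). -/
theorem dimZero_one_balanced (r : KZ.IntegralRep 1) (r' : KZ.IntegralRep 0)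
    (a b : (Fin 0 → ℝ) → ℝ) (h : (Fin 0 → ℝ) → ℝ) (V : (Fin 1 → ℝ) → ℝ)
    (ha : IsSemialgebraicFunOn ℚ r'.domain a) (hb : IsSemialgebraicFunOn ℚ r'.domain b)
    (hab : ∀ x ∈ r'.domain, a x ≤ b x)
    (hdom : r.domain = {z | (Fin.init z : Fin 0 → ℝ) ∈ r'.domain ∧ a (Fin.init z) ≤ z (Fin.last 0) ∧
      z (Fin.last 0) ≤ b (Fin.init z)})
    (hh : IsSemialgebraicFunOn ℚ r'.domain h) (hV : IsSemialgebraicFunOn ℚ r.domain V)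
    (hpos : ∀ z ∈ r.domain, 0 < V z)
    (hr' : ∀ x ∈ r'.domain, r'.integrand x =
      h x * (Real.log (V (Fin.snoc x (b x))) - Real.log (V (Fin.snoc x (a x)))))
    {x : Fin 0 → ℝ} (hx : x ∈ r'.domain) :
    h x = 0 ∨ V (Fin.snoc x (b x)) = V (Fin.snoc x (a x)) := by
  have hBmem : ∀ y ∈ r'.domain, (Fin.snoc y (b y) : Fin 1 → ℝ) ∈ r.domain := fun y hy =>
    (snoc_mem_band_iff hdom).2 ⟨hy, hab y hy, le_rfl⟩
  have hAmem : ∀ y ∈ r'.domain, (Fin.snoc y (a y) : Fin 1 → ℝ) ∈ r.domain := fun y hy =>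
    (snoc_mem_band_iff hdom).2 ⟨hy, le_rfl, hab y hy⟩
  have algh : IsAlgebraic ℚ (h x) := isAlgebraic_of_isSemialgebraicFunOn_fin_zero hh hx
  have algr : IsAlgebraic ℚ (r'.integrand x) :=
    isAlgebraic_of_isSemialgebraicFunOn_fin_zero r'.isSemialgebraicFunOn_integrand hx
  have algB : IsAlgebraic ℚ (V (Fin.snoc x (b x))) :=
    isAlgebraic_of_isSemialgebraicFunOn_fin_zero
      (isSemialgebraicFunOn_endpoint r'.isSemialgebraic_domain hb hV hBmem) hx
  have algA : IsAlgebraic ℚ (V (Fin.snoc x (a x))) :=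
    isAlgebraic_of_isSemialgebraicFunOn_fin_zero
      (isSemialgebraicFunOn_endpoint r'.isSemialgebraic_domain ha hV hAmem) hx
  by_cases h0 : h x = 0
  · exact Or.inl h0
  right
  have hBpos : 0 < V (Fin.snoc x (b x)) := hpos _ (hBmem x hx)
  have hApos : 0 < V (Fin.snoc x (a x)) := hpos _ (hAmem x hx)
  have hquot : Real.log (V (Fin.snoc x (b x)) / V (Fin.snoc x (a x))) = r'.integrand x / h x := by
    rw [Real.log_div hBpos.ne' hApos.ne', hr' x hx]
    field_simp
  have alglog : IsAlgebraic ℚ (Real.log (V (Fin.snoc x (b x)) / V (Fin.snoc x (a x)))) := by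
    rw [hquot, div_eq_mul_inv]
    exact algr.mul algh.inv
  have hz := log_eq_zero_of_isAlgebraic (div_pos hBpos hApos)
    (by rw [div_eq_mul_inv]; exact algB.mul algA.inv) alglog
  have h1 := Real.eq_one_of_pos_of_log_eq_zero (div_pos hBpos hApos) hz
  rwa [div_eq_one_iff_eq hApos.ne'] at h1

end DimZeroRigidity

/-! ### All `k` over the point: Baker -/

/-- **Baker, inhomogeneous corollary** (from `baker_holds`, Baker 1975 Thm. 2.1): an ALGEBRAIC value
`β₀ = Σ βᵢ lᵢ` of a linear form with algebraic coefficients `βᵢ` in logarithms `lᵢ` of algebraic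
numbers (`e^{lᵢ} ∈ ℚ̄`) is `0`. Proof: pass to a maximal `ℚ`-independent subfamily `b` of the `lᵢ`
(`exists_linearIndependent`); Baker makes `1, b` linearly independent over `ℚ̄`, so `1 ∉ span_ℚ̄ b`,
while `β₀ ∈ span_ℚ̄ (lᵢ) = span_ℚ̄ b`; if `β₀ ≠ 0` then `1 = β₀⁻¹ β₀ ∈ span_ℚ̄ b`. -/
theorem baker_sum_eq_zero {k : ℕ} (l β : Fin k → ℂ) (β₀ : ℂ)
    (halg : ∀ i, IsAlgebraic ℚ (Complex.exp (l i))) (hβ : ∀ i, IsAlgebraic ℚ (β i))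
    (hβ₀ : IsAlgebraic ℚ β₀) (hsum : ∑ i, β i * l i = β₀) : β₀ = 0 := by
  classical
  by_contra h0
  set K := algebraicClosure ℚ ℂ with hK
  obtain ⟨b, hb_sub, hb_span, hb_li⟩ := exists_linearIndependent ℚ (Set.range l)
  have halg' : ∀ x : b, IsAlgebraic ℚ (Complex.exp (x : ℂ)) := fun x => by
    obtain ⟨i, hi⟩ := hb_sub x.2
    rw [← hi]
    exact halg i
  have hB := baker_holds (fun x : b => (x : ℂ)) halg' hb_li
  have hmem_range : β₀ ∈ Submodule.span K (Set.range l) := by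
    rw [← hsum]
    refine Submodule.sum_mem _ fun i _ => ?_
    have hβi : β i ∈ K := mem_algebraicClosure_iff.mpr (hβ i)
    have : β i * l i = (⟨β i, hβi⟩ : K) • l i := by
      rw [IntermediateField.smul_def]
      rfl
    rw [this]
    exact Submodule.smul_mem _ _ (Submodule.subset_span ⟨i, rfl⟩)
  have hle : Submodule.span K (Set.range l) ≤ Submodule.span K (b : Set ℂ) := by
    rw [Submodule.span_le]
    intro x hx
    have hx' : x ∈ Submodule.span ℚ (b : Set ℂ) := by
      rw [hb_span]
      exact Submodule.subset_span hx
    exact Submodule.span_le_restrictScalars ℚ K (b : Set ℂ) hx'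
  have hmem : β₀ ∈ Submodule.span K (b : Set ℂ) := hle hmem_range
  have himage : (fun o : Option b => o.elim (1 : ℂ) (fun x : b => (x : ℂ))) '' Set.range some =
      (b : Set ℂ) := by
    ext y
    simp only [Set.mem_image, Set.mem_range, exists_exists_eq_and, Option.elim_some]
    exact ⟨fun ⟨x, hx⟩ => hx ▸ x.2, fun hy => ⟨⟨y, hy⟩, rfl⟩⟩
  have h1 : (1 : ℂ) ∉ Submodule.span K (b : Set ℂ) := by
    have := hB.notMem_span_image (s := Set.range some) (x := none) (by simp)
    rwa [himage] at this
  have hβ₀K : β₀ ∈ K := mem_algebraicClosure_iff.mpr hβ₀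
  have : (1 : ℂ) = (⟨β₀, hβ₀K⟩ : K)⁻¹ • β₀ := by
    rw [IntermediateField.smul_def]
    change (1 : ℂ) = ((⟨β₀, hβ₀K⟩ : K)⁻¹ : K) * β₀
    rw [show (((⟨β₀, hβ₀K⟩ : K)⁻¹ : K) : ℂ) = β₀⁻¹ from rfl, inv_mul_cancel₀ h0]
  exact h1 (this ▸ Submodule.smul_mem _ _ hmem)

/-- **Over the point, EVERY admissible boundary representation is `[pt, 0]`** (all `k`; rigidity
§7.3(i) at `n = 0`, PROVED from Baker): in a datum of the crux with `n = 0` (only the hypotheses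
listed are used), `r'.integrand x = 0` at the base point — `r'.integrand x = Σ hᵢ · log(Bᵢ/Aᵢ)` is an
algebraic value of a `ℚ̄`-linear form in logarithms of the algebraic numbers `Bᵢ/Aᵢ = Vᵢ(b)/Vᵢ(a)`
(`baker_sum_eq_zero`). Hence at `n = 0` the crux is exactly the derivability of `[r] ∈ KZ.relations`
for every admissible band datum (`dimZero_of_sub_mem`). -/
theorem dimZero_boundary_eq_zero {k : ℕ} (r : KZ.IntegralRep 1) (r' : KZ.IntegralRep 0)
    (a b : (Fin 0 → ℝ) → ℝ) (h : Fin k → (Fin 0 → ℝ) → ℝ) (V : Fin k → (Fin 1 → ℝ) → ℝ)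
    (ha : IsSemialgebraicFunOn ℚ r'.domain a) (hb : IsSemialgebraicFunOn ℚ r'.domain b)
    (hab : ∀ x ∈ r'.domain, a x ≤ b x)
    (hdom : r.domain = {z | (Fin.init z : Fin 0 → ℝ) ∈ r'.domain ∧ a (Fin.init z) ≤ z (Fin.last 0) ∧
      z (Fin.last 0) ≤ b (Fin.init z)})
    (hh : ∀ i, IsSemialgebraicFunOn ℚ r'.domain (h i))
    (hV : ∀ i, IsSemialgebraicFunOn ℚ r.domain (V i))
    (hpos : ∀ i, ∀ z ∈ r.domain, 0 < V i z)
    (hr' : ∀ x ∈ r'.domain, r'.integrand x =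
      ∑ i, h i x * (Real.log (V i (Fin.snoc x (b x))) - Real.log (V i (Fin.snoc x (a x)))))
    {x : Fin 0 → ℝ} (hx : x ∈ r'.domain) : r'.integrand x = 0 := by
  have hBmem : ∀ y ∈ r'.domain, (Fin.snoc y (b y) : Fin 1 → ℝ) ∈ r.domain := fun y hy =>
    (snoc_mem_band_iff hdom).2 ⟨hy, hab y hy, le_rfl⟩
  have hAmem : ∀ y ∈ r'.domain, (Fin.snoc y (a y) : Fin 1 → ℝ) ∈ r.domain := fun y hy =>
    (snoc_mem_band_iff hdom).2 ⟨hy, le_rfl, hab y hy⟩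
  set B : Fin k → ℝ := fun i => V i (Fin.snoc x (b x)) with hBdef
  set A : Fin k → ℝ := fun i => V i (Fin.snoc x (a x)) with hAdef
  have hBpos : ∀ i, 0 < B i := fun i => hpos i _ (hBmem x hx)
  have hApos : ∀ i, 0 < A i := fun i => hpos i _ (hAmem x hx)
  have algh : ∀ i, IsAlgebraic ℚ (h i x) := fun i => isAlgebraic_of_isSemialgebraicFunOn_fin_zero (hh i) hx
  have algr : IsAlgebraic ℚ (r'.integrand x) :=
    isAlgebraic_of_isSemialgebraicFunOn_fin_zero r'.isSemialgebraicFunOn_integrand hx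
  have algB : ∀ i, IsAlgebraic ℚ (B i) := fun i =>
    isAlgebraic_of_isSemialgebraicFunOn_fin_zero
      (isSemialgebraicFunOn_endpoint r'.isSemialgebraic_domain hb (hV i) hBmem) hx
  have algA : ∀ i, IsAlgebraic ℚ (A i) := fun i =>
    isAlgebraic_of_isSemialgebraicFunOn_fin_zero
      (isSemialgebraicFunOn_endpoint r'.isSemialgebraic_domain ha (hV i) hAmem) hx
  -- complexify and apply Baker
  have hquot : ∀ i, Real.log (B i) - Real.log (A i) = Real.log (B i / A i) := fun i =>
    (Real.log_div (hBpos i).ne' (hApos i).ne').symm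
  have hsumR : r'.integrand x = ∑ i, h i x * Real.log (B i / A i) := by
    rw [hr' x hx]
    exact Finset.sum_congr rfl fun i _ => by rw [← hquot i]
  have hsumC : ∑ i, ((h i x : ℝ) : ℂ) * ((Real.log (B i / A i) : ℝ) : ℂ) = ((r'.integrand x : ℝ) : ℂ) := by
    rw [hsumR]
    push_cast
    rfl
  have halg : ∀ i, IsAlgebraic ℚ (Complex.exp ((Real.log (B i / A i) : ℝ) : ℂ)) := fun i => by
    rw [← Complex.ofReal_exp, Real.exp_log (div_pos (hBpos i) (hApos i)), div_eq_mul_inv]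
    exact ((algB i).mul (algA i).inv).algebraMap
  have h0 := baker_sum_eq_zero (fun i => ((Real.log (B i / A i) : ℝ) : ℂ)) (fun i => ((h i x : ℝ) : ℂ))
    ((r'.integrand x : ℝ) : ℂ) halg (fun i => (algh i).algebraMap) algr.algebraMap hsumC
  exact_mod_cast h0

/-- **At `n = 0` the base side is a relation**: for an admissible datum over the point,
`[r'] ∈ KZ.relations` (its integrand vanishes on its domain, `dimZero_boundary_eq_zero`), so the
crux's conclusion `[r] − [r'] ∈ relations` is equivalent to `[r] ∈ relations` there. -/
theorem dimZero_base_mem_relations {k : ℕ} (r : KZ.IntegralRep 1) (r' : KZ.IntegralRep 0)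
    (a b : (Fin 0 → ℝ) → ℝ) (h : Fin k → (Fin 0 → ℝ) → ℝ) (V : Fin k → (Fin 1 → ℝ) → ℝ)
    (ha : IsSemialgebraicFunOn ℚ r'.domain a) (hb : IsSemialgebraicFunOn ℚ r'.domain b)
    (hab : ∀ x ∈ r'.domain, a x ≤ b x)
    (hdom : r.domain = {z | (Fin.init z : Fin 0 → ℝ) ∈ r'.domain ∧ a (Fin.init z) ≤ z (Fin.last 0) ∧
      z (Fin.last 0) ≤ b (Fin.init z)})
    (hh : ∀ i, IsSemialgebraicFunOn ℚ r'.domain (h i))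
    (hV : ∀ i, IsSemialgebraicFunOn ℚ r.domain (V i))
    (hpos : ∀ i, ∀ z ∈ r.domain, 0 < V i z)
    (hr' : ∀ x ∈ r'.domain, r'.integrand x =
      ∑ i, h i x * (Real.log (V i (Fin.snoc x (b x))) - Real.log (V i (Fin.snoc x (a x))))) :
    KZ.of r' ∈ KZ.relations :=
  KZ.of_mem_relations_of_eqOn_zero r' fun _ hx =>
    dimZero_boundary_eq_zero r r' a b h V ha hb hab hdom hh hV hpos hr' hx


end Summit.KontsevichZagierPeriods.LiouvilleUnfolding.LogPrimitiveNL.Negative
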